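import Literature.Probability.Percolation.BlockResampling
import Literature.Probability.Percolation.ColourSwitching
import Mathlib.MeasureTheory.Function.ConditionalExpectation.PullOut
import HarnessLib

/-!
# Conditioning on the data of a stopping set: the adaptive conditional probability and its `L²`-minimality

Topic `Literature/Probability/Percolation`; Bernoulli bond percolation `P_p = bondPercolation G p` on an
arbitrary countable graph.  Proofs-and-definitions support file (no named fact) for the
mesh-independent gluing Proposition 4.1 of O. Schramm, S. Smirnov, *On the scaling limits of planar
percolation*, Ann. Probab. 39 (2011) 1768–1814, arXiv:1101.5820, §4 (pp. 18 and 20 of the arXiv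
version), whose probabilistic mechanism is conditioning on the data of an EXPLORED random set of
tiles `M = M(ω)`:

> "The following property of `M` is essential: given `M` and the restriction of `ω` to it, the
> conditional law of the restriction of `ω` to `M'` (i.e., the complement of `M`) is unbiased.  In
> other words, if we take `ω₁` independent from `ω` and of the same law, and we define `ω₂` to agree
> with `ω` on `M` and to agree with `ω₁` elsewhere, then `ω₂` also has the law `P_η`.  This follows
> directly from the fact that `M(ω₂) = M(ω)`." (p. 18)  "… we set
> `Ỹ = Ỹ(ω) := P_η(ω̃ ∈ ⊞_{Q₀} | ω|_M)`. … Since `Y_s` is `𝓕_s`-measurable, it is also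
> `ω|_M`-measurable.  By its definition, `Ỹ` minimizes `‖Ỹ₀ - X‖₂²` among `ω|_M`-measurable random
> variables `X`.  Therefore, comparison to `Y_s` (recall that the set `M` includes the complement of
> the `s`-neighborhood of `α`) yields `‖Ỹ₀ - Ỹ‖₂ ≤ ‖Ỹ₀ - Y_s‖₂`." (p. 20)

Here "`M(ω₂) = M(ω)`" is the STOPPING property of the explored set (`IsStoppingSet`,
`ColourSwitching.lean`: configurations agreeing on `N(ω)` have the same `N`), and everything is the
percolation-free content of the two quoted sentences, for a stopping set `N` of edges with values
in a finite window `G₀` (the unexplored, resampled block being `G₀ ∖ N(ω)`):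

* `stoppedSigma G₀ N` — **the σ-algebra of the explored data** `σ(M, ω|_M)`: the measurable events
  decided by the states of the edges of `N(ω)` and of the edges off the window `G₀`;
  `stoppedSigma_le`; the pieces `{N = F}` belong to it (`measurableSet_stoppedSigma_setOf_apply_eq`);
* `stoppedCondProb G p G₀ N E ω = P_p(E | ω off (G₀ ∖ N ω))` — **the adaptive conditional
  probability `Ỹ`** (the tree's written-out `blockCondProb`, `BlockResampling.lean`, at the random
  block `G₀ ∖ N(ω)`); `0 ≤ Ỹ ≤ 1`, measurable, and `stoppedSigma`-measurable
  (`measurable_stoppedCondProb_stoppedSigma`);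
* `setIntegral_stoppedCondProb` — **unbiasedness**: `∫_A Ỹ dP_p = ∫_A 𝟙_E dP_p` for every event `A`
  of the explored data (on each piece `{N = F}` the event `A` is an event of the edges off
  `G₀ ∖ F`, and `P_p(E | ω off B)` is a version of `E_p[𝟙_E | σ(Bᶜ)]`,
  `blockCondProb_ae_eq_condExp`); hence `Ỹ` is a version of Mathlib's conditional expectation
  `P_p[𝟙_E | stoppedSigma G₀ N]` (`stoppedCondProb_ae_eq_condExp`) and `∫ Ỹ g = ∫ 𝟙_E g` for bounded
  data-measurable `g` (`integral_stoppedCondProb_mul`);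
* `integral_sq_indicator_sub_stoppedCondProb_le` — **`L²`-minimality**: `‖𝟙_E - Ỹ‖₂ ≤ ‖𝟙_E - X‖₂`
  for every bounded `stoppedSigma`-measurable `X` (Pythagoras), and its instance
  `integral_sq_indicator_sub_stoppedCondProb_le_blockCondProb`: `‖𝟙_E - Ỹ‖₂ ≤ ‖𝟙_E - P_p(E' | ω off B)‖₂`
  for ANY event `E'` and any block `B` containing every unexplored block `G₀ ∖ N(ω)` ("`Y_s` is
  `ω|_M`-measurable" because `M` always contains the complement of the `s`-neighbourhood);
* pointwise API: `stoppedCondProb_congr` (a function of the data), `abs_stoppedCondProb_sub_le`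
  (`|Ỹ_{E₁} - Ỹ_{E₂}| ≤ Ỹ_{E₁ Δ E₂}`), `stoppedCondProb_inter_eq_indicator_mul` (`Ỹ_{A ∩ E} = 𝟙_A Ỹ_E`
  for data events `A`), `integral_stoppedCondProb` (`E[Ỹ] = P_p(E)`).

## References

* O. Schramm, S. Smirnov, Ann. Probab. 39 (2011) 1768–1814, arXiv:1101.5820, §4, proof of
  Prop. 4.1 ("Bays and beaches", p. 18; "Final estimates", p. 20). [SchrammSmirnov2011]
* B. Bollobás, O. Riordan, *Percolation*, CUP (2006), Ch. 7, proof of Lemma 6, p. 175 (stopping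
  sets). [BollobasRiordan2006]
* G. Grimmett, *Percolation*, 2nd ed. (1999), §2.2 (product structure, events of a set of
  edges). [GrimmettPercolation1999]

Tree: `IsStoppingSet` (`ColourSwitching.lean`), `blockCondProb`, `blockCondProb_ae_eq_condExp`,
`blockCondProb_eq_real`, `measurable_blockCondProb` (`BlockResampling.lean`), `DeterminedBy`,
`determinedBy_iff`, `DeterminedBy.measurableSet_of_finset` (`PercolationEvents.lean`),
`DeterminedBy.measurableSet_edgeSigma`, `edgeSigma_le` (`FiniteEnergy.lean`).  Mathlib:
`ae_eq_condExp_of_forall_setIntegral_eq`, `setIntegral_condExp`, `integral_condExp`,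
`condExp_mul_of_stronglyMeasurable_left`, `integral_biUnion_finset`.
-/

noncomputable section

open MeasureTheory ProbabilityTheory Set

namespace Literature.Probability.Percolation

variable {V : Type*} [DecidableEq V]

/-! ### The σ-algebra of the explored data -/

/-- **The σ-algebra of the explored data** of a random set of edges `N` inside the window `G₀`
("given `M` and the restriction of `ω` to it"): the measurable events `A` decided by the states
of the edges of `N(ω)` together with the states of the edges off `G₀` — configurations agreeing
there agree on membership in `A`.  (For a stopping set `N` such configurations have the same
`N`.) [cite: SchrammSmirnov2011, §4, proof of Prop. 4.1 (p. 18, "given M and the restriction of ω to it")] -/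
@[reducible] def stoppedSigma (G₀ : Finset (Sym2 V)) (N : BondConfig V → Finset (Sym2 V)) :
    MeasurableSpace (BondConfig V) where
  MeasurableSet' A := MeasurableSet A ∧
    ∀ ω ω' : BondConfig V, (∀ e, e ∈ N ω ∨ e ∉ G₀ → (e ∈ ω ↔ e ∈ ω')) → (ω ∈ A ↔ ω' ∈ A)
  measurableSet_empty := ⟨MeasurableSet.empty, fun _ _ _ => Iff.rfl⟩
  measurableSet_compl A hA := ⟨hA.1.compl, fun ω ω' h => not_congr (hA.2 ω ω' h)⟩
  measurableSet_iUnion f hf := ⟨MeasurableSet.iUnion fun i => (hf i).1, fun ω ω' h => by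
    simp only [mem_iUnion]
    exact exists_congr fun i => (hf i).2 ω ω' h⟩

omit [DecidableEq V] in
/-- Unfolding of `stoppedSigma`-measurability. [folklore] -/
theorem measurableSet_stoppedSigma_iff {G₀ : Finset (Sym2 V)} {N : BondConfig V → Finset (Sym2 V)}
    {A : Set (BondConfig V)} :
    MeasurableSet[stoppedSigma G₀ N] A ↔ MeasurableSet A ∧
      ∀ ω ω' : BondConfig V, (∀ e, e ∈ N ω ∨ e ∉ G₀ → (e ∈ ω ↔ e ∈ ω')) → (ω ∈ A ↔ ω' ∈ A) :=
  Iff.rfl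

omit [DecidableEq V] in
/-- The data σ-algebra is coarser than the product σ-algebra. [folklore] -/
theorem stoppedSigma_le (G₀ : Finset (Sym2 V)) (N : BondConfig V → Finset (Sym2 V)) :
    stoppedSigma G₀ N ≤ (Set.instMeasurableSpace : MeasurableSpace (BondConfig V)) :=
  fun _ hA => hA.1

section Stopping

variable {G₀ : Finset (Sym2 V)} {N : BondConfig V → Finset (Sym2 V)}

omit [DecidableEq V] in
/-- For a stopping set, configurations agreeing on the explored data have the same explored set
("`M(ω₂) = M(ω)`"). [cite: SchrammSmirnov2011, §4, proof of Prop. 4.1 (p. 18)] -/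
theorem IsStoppingSet.apply_eq_of_agree (hN : IsStoppingSet N) {ω ω' : BondConfig V}
    (h : ∀ e, e ∈ N ω ∨ e ∉ G₀ → (e ∈ ω ↔ e ∈ ω')) : N ω' = N ω :=
  hN ω ω' fun e he => h e (Or.inl he)

omit [DecidableEq V] in
/-- The agreement relation on the explored data is symmetric for a stopping set. [folklore] -/
theorem IsStoppingSet.agree_symm (hN : IsStoppingSet N) {ω ω' : BondConfig V}
    (h : ∀ e, e ∈ N ω ∨ e ∉ G₀ → (e ∈ ω ↔ e ∈ ω')) :
    ∀ e, e ∈ N ω' ∨ e ∉ G₀ → (e ∈ ω' ↔ e ∈ ω) := by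
  rw [hN.apply_eq_of_agree h]
  exact fun e he => (h e he).symm

omit [DecidableEq V] in
/-- **Each piece `{N = F}` is determined by the edges of `F`** (stopping property).
[cite: BollobasRiordan2006, Ch. 7 proof of Lemma 6 p. 175] -/
theorem IsStoppingSet.determinedBy_setOf_apply_eq (hN : IsStoppingSet N) (F : Finset (Sym2 V)) :
    DeterminedBy {ω : BondConfig V | N ω = F} (↑F : Set (Sym2 V)) := by
  rw [determinedBy_iff]
  intro ω ω' hωω'
  have key : ∀ {ω ω' : BondConfig V}, ω ∩ ↑F = ω' ∩ ↑F → N ω = F → N ω' = F := by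
    intro ω ω' h hF
    rw [← hF]
    refine hN ω ω' fun e he => ?_
    rw [hF] at he
    have := congrArg (fun S : Set (Sym2 V) => e ∈ S) h
    simp only [mem_inter_iff, Finset.mem_coe, he, and_true, eq_iff_iff] at this
    exact this
  exact ⟨key hωω', key hωω'.symm⟩

omit [DecidableEq V] in
/-- The pieces `{N = F}` are measurable. [folklore] -/
theorem IsStoppingSet.measurableSet_setOf_apply_eq (hN : IsStoppingSet N) (F : Finset (Sym2 V)) :
    MeasurableSet {ω : BondConfig V | N ω = F} :=
  (hN.determinedBy_setOf_apply_eq F).measurableSet_of_finset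

omit [DecidableEq V] in
/-- The pieces `{N = F}` are events of the explored data. [cite: SchrammSmirnov2011, §4, proof of Prop. 4.1 (p. 18)] -/
theorem IsStoppingSet.measurableSet_stoppedSigma_setOf_apply_eq (hN : IsStoppingSet N)
    (F : Finset (Sym2 V)) : MeasurableSet[stoppedSigma G₀ N] {ω : BondConfig V | N ω = F} := by
  refine ⟨hN.measurableSet_setOf_apply_eq F, fun ω ω' h => ?_⟩
  simp only [mem_setOf_eq, hN.apply_eq_of_agree h]

/-- **On a piece, a data event is an event of the edges off the unexplored block**: for
`A ∈ stoppedSigma G₀ N`, the event `A ∩ {N = F}` is determined by the edges off `G₀ ∖ F`.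
[cite: SchrammSmirnov2011, §4, proof of Prop. 4.1 (p. 18)] -/
theorem IsStoppingSet.determinedBy_inter_setOf_apply_eq (hN : IsStoppingSet N)
    {A : Set (BondConfig V)} (hA : MeasurableSet[stoppedSigma G₀ N] A) (F : Finset (Sym2 V)) :
    DeterminedBy (A ∩ {ω : BondConfig V | N ω = F}) ((↑(G₀ \ F) : Set (Sym2 V))ᶜ) := by
  rw [determinedBy_iff]
  have key : ∀ {ω ω' : BondConfig V}, ω ∩ (↑(G₀ \ F) : Set (Sym2 V))ᶜ = ω' ∩ (↑(G₀ \ F))ᶜ →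
      ω ∈ A ∩ {ω : BondConfig V | N ω = F} → ω' ∈ A ∩ {ω : BondConfig V | N ω = F} := by
    intro ω ω' h ⟨hωA, hωF⟩
    have hagree : ∀ e, e ∈ N ω ∨ e ∉ G₀ → (e ∈ ω ↔ e ∈ ω') := by
      intro e he
      have he' : e ∈ (↑(G₀ \ F) : Set (Sym2 V))ᶜ := by
        simp only [mem_compl_iff, Finset.coe_sdiff, Set.mem_sdiff, Finset.mem_coe, not_and, not_not]
        intro heG
        rcases he with he | he
        · rw [mem_setOf_eq] at hωF; rwa [hωF] at he
        · exact absurd heG he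
      have := congrArg (fun S : Set (Sym2 V) => e ∈ S) h
      simp only [mem_inter_iff, he', and_true, eq_iff_iff] at this
      exact this
    exact ⟨(hA.2 ω ω' hagree).1 hωA, by rw [mem_setOf_eq, hN.apply_eq_of_agree hagree]; exact hωF⟩
  intro ω ω' h
  exact ⟨key h, key h.symm⟩

/-- Hence `A ∩ {N = F}` is `σ((G₀ ∖ F)ᶜ)`-measurable for every data event `A`. [folklore] -/
theorem IsStoppingSet.measurableSet_edgeSigma_inter_setOf_apply_eq (hN : IsStoppingSet N)
    {A : Set (BondConfig V)} (hA : MeasurableSet[stoppedSigma G₀ N] A) (F : Finset (Sym2 V)) :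
    MeasurableSet[edgeSigma ((↑(G₀ \ F) : Set (Sym2 V))ᶜ)] (A ∩ {ω : BondConfig V | N ω = F}) :=
  (hN.determinedBy_inter_setOf_apply_eq hA F).measurableSet_edgeSigma
    (hA.1.inter (hN.measurableSet_setOf_apply_eq F))

end Stopping

/-! ### The adaptive conditional probability `Ỹ = P_p(E | explored data)` -/

section CondProb

variable (G : SimpleGraph V) (p : unitInterval)

/-- **`Ỹ = P_p(E | ω|_M)`**, the conditional probability of `E` given the explored data: the
written-out conditional probability `P_p(E | ω off B)` of `BlockResampling.lean` at the random
unexplored block `B = G₀ ∖ N(ω)` ("if we take `ω₁` independent from `ω` and of the same law, and we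
define `ω₂` to agree with `ω` on `M` and to agree with `ω₁` elsewhere").
[cite: SchrammSmirnov2011, §4, proof of Prop. 4.1 (p. 18 and p. 19, "Ỹ := P_η(ω̃ ∈ ⊞_{Q₀} | ω|_M)")] -/
def stoppedCondProb (G₀ : Finset (Sym2 V)) (N : BondConfig V → Finset (Sym2 V))
    (E : Set (BondConfig V)) (ω : BondConfig V) : ℝ :=
  blockCondProb G p (G₀ \ N ω) E ω

variable {G₀ : Finset (Sym2 V)} {N : BondConfig V → Finset (Sym2 V)}

omit [DecidableEq V] in
/-- `P_p(E | ω off B)` depends only on the configuration off `B`. [cite: SchrammSmirnov2011, Thm. 1.1 (𝓕_s)] -/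
theorem blockCondProb_congr_off (B : Finset (Sym2 V)) (E : Set (BondConfig V)) {ω ω' : BondConfig V}
    (h : ∀ e, e ∉ B → (e ∈ ω ↔ e ∈ ω')) : blockCondProb G p B E ω = blockCondProb G p B E ω' := by
  unfold blockCondProb
  refine Finset.sum_congr rfl fun ξ _ => ?_
  have hset : ω \ ↑B ∪ ↑ξ = ω' \ ↑B ∪ (↑ξ : Set (Sym2 V)) := by
    ext e
    simp only [mem_union, Set.mem_sdiff, Finset.mem_coe]
    constructor
    · rintro (⟨h1, h2⟩ | h3)
      · exact Or.inl ⟨(h e h2).1 h1, h2⟩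
      · exact Or.inr h3
    · rintro (⟨h1, h2⟩ | h3)
      · exact Or.inl ⟨(h e h2).2 h1, h2⟩
      · exact Or.inr h3
  rw [hset]

/-- **`Ỹ` is a function of the explored data** (stopping property). [cite: SchrammSmirnov2011, §4, proof of Prop. 4.1 (p. 18)] -/
theorem stoppedCondProb_congr (hN : IsStoppingSet N) (E : Set (BondConfig V)) {ω ω' : BondConfig V}
    (h : ∀ e, e ∈ N ω ∨ e ∉ G₀ → (e ∈ ω ↔ e ∈ ω')) :
    stoppedCondProb G p G₀ N E ω = stoppedCondProb G p G₀ N E ω' := by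
  unfold stoppedCondProb
  rw [hN.apply_eq_of_agree h]
  refine blockCondProb_congr_off G p _ E fun e he => h e ?_
  by_cases heG : e ∈ G₀
  · left
    by_contra heN
    exact he (Finset.mem_sdiff.2 ⟨heG, heN⟩)
  · exact Or.inr heG

/-- `Ỹ` as a finite sum over the pieces: `Ỹ = Σ_{F ⊆ G₀} 𝟙_{N = F} · P_p(E | ω off (G₀ ∖ F))`.
[folklore] -/
theorem stoppedCondProb_eq_sum (hNG : ∀ ω, N ω ⊆ G₀) (E : Set (BondConfig V)) (ω : BondConfig V) :
    stoppedCondProb G p G₀ N E ω = ∑ F ∈ G₀.powerset,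
      {ω : BondConfig V | N ω = F}.indicator (1 : BondConfig V → ℝ) ω * blockCondProb G p (G₀ \ F) E ω := by
  rw [Finset.sum_eq_single (N ω)]
  · rw [Set.indicator_of_mem (by exact rfl), Pi.one_apply, one_mul]; rfl
  · intro F _ hF
    rw [Set.indicator_of_notMem (fun h => hF h.symm), zero_mul]
  · intro h
    exact absurd (Finset.mem_powerset.2 (hNG ω)) h

/-- `Ỹ` is measurable (for a stopping set and a measurable event). [folklore] -/
theorem measurable_stoppedCondProb (hN : IsStoppingSet N) (hNG : ∀ ω, N ω ⊆ G₀)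
    {E : Set (BondConfig V)} (hE : MeasurableSet E) : Measurable (stoppedCondProb G p G₀ N E) := by
  have h : stoppedCondProb G p G₀ N E = fun ω => ∑ F ∈ G₀.powerset,
      {ω : BondConfig V | N ω = F}.indicator (1 : BondConfig V → ℝ) ω * blockCondProb G p (G₀ \ F) E ω :=
    funext (stoppedCondProb_eq_sum G p hNG E)
  rw [h]
  refine Finset.measurable_sum _ fun F _ => ?_
  exact (measurable_one.indicator (hN.measurableSet_setOf_apply_eq F)).mul
    (measurable_blockCondProb G p _ hE)

/-- **`Ỹ` is measurable with respect to the explored data.** [cite: SchrammSmirnov2011, §4, proof of Prop. 4.1 (p. 20, "Ỹ … among ω|_M-measurable random variables")] -/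
theorem measurable_stoppedCondProb_stoppedSigma (hN : IsStoppingSet N) (hNG : ∀ ω, N ω ⊆ G₀)
    {E : Set (BondConfig V)} (hE : MeasurableSet E) :
    Measurable[stoppedSigma G₀ N] (stoppedCondProb G p G₀ N E) := by
  intro T hT
  refine ⟨measurable_stoppedCondProb G p hN hNG hE hT, fun ω ω' h => ?_⟩
  simp only [mem_preimage, stoppedCondProb_congr G p hN E h]

/-- A block function `P_p(E' | ω off B)` whose block contains every unexplored block is measurable
with respect to the explored data ("Since `Y_s` is `𝓕_s`-measurable, it is also
`ω|_M`-measurable … recall that the set `M` includes the complement of the `s`-neighborhood of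
`α`"). [cite: SchrammSmirnov2011, §4, proof of Prop. 4.1 (p. 20)] -/
theorem measurable_blockCondProb_stoppedSigma (B : Finset (Sym2 V)) (hB : ∀ ω, G₀ \ N ω ⊆ B)
    {E' : Set (BondConfig V)} (hE' : MeasurableSet E') :
    Measurable[stoppedSigma G₀ N] (blockCondProb G p B E') := by
  intro T hT
  refine ⟨measurable_blockCondProb G p B hE' hT, fun ω ω' h => ?_⟩
  have heq : blockCondProb G p B E' ω = blockCondProb G p B E' ω' := by
    refine blockCondProb_congr_off G p B E' fun e he => h e ?_
    by_cases heG : e ∈ G₀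
    · left
      by_contra heN
      exact he (hB ω (Finset.mem_sdiff.2 ⟨heG, heN⟩))
    · exact Or.inr heG
  simp only [mem_preimage, heq]

end CondProb

section CondProbSum

variable [Countable V] (G : SimpleGraph V) (p : unitInterval)
variable {G₀ : Finset (Sym2 V)} {N : BondConfig V → Finset (Sym2 V)}

/-- `Ỹ = P_p{ζ | ω off the unexplored block, glued with ζ on it, lies in E}`. [cite: SchrammSmirnov2011, §4, proof of Prop. 4.1 (p. 18, ω₂)] -/
theorem stoppedCondProb_eq_real (E : Set (BondConfig V)) (ω : BondConfig V) :
    stoppedCondProb G p G₀ N E ω =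
      (bondPercolation G p).real {ζ | ω \ ↑(G₀ \ N ω) ∪ ↑(obs ζ (G₀ \ N ω)) ∈ E} :=
  blockCondProb_eq_real G p _ E ω

/-- `0 ≤ Ỹ`. [folklore] -/
theorem stoppedCondProb_nonneg (E : Set (BondConfig V)) (ω : BondConfig V) :
    0 ≤ stoppedCondProb G p G₀ N E ω :=
  blockCondProb_nonneg G p _ E ω

/-- `Ỹ ≤ 1`. [folklore] -/
theorem stoppedCondProb_le_one (E : Set (BondConfig V)) (ω : BondConfig V) :
    stoppedCondProb G p G₀ N E ω ≤ 1 :=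
  blockCondProb_le_one G p _ E ω

/-- `|Ỹ| ≤ 1`. [folklore] -/
theorem abs_stoppedCondProb_le (E : Set (BondConfig V)) (ω : BondConfig V) :
    |stoppedCondProb G p G₀ N E ω| ≤ 1 := by
  rw [abs_of_nonneg (stoppedCondProb_nonneg G p E ω)]
  exact stoppedCondProb_le_one G p E ω

/-- **`|Ỹ_{E₁} - Ỹ_{E₂}| ≤ Ỹ_{E₁ Δ E₂}`** (for measurable events): conditional probabilities of two
events differ by at most the conditional probability of their symmetric difference — the form in
which "`|Ỹ_T - Ỹ| 𝟙_{¬𝒮} ≤ P_η(G^T ≠ G*, ¬𝒮 | ω|_M)`" is used. [cite: SchrammSmirnov2011, §4, proof of Prop. 4.1 (p. 20, "Final estimates")] -/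
theorem abs_stoppedCondProb_sub_le (E₁ E₂ : Set (BondConfig V)) (ω : BondConfig V) :
    |stoppedCondProb G p G₀ N E₁ ω - stoppedCondProb G p G₀ N E₂ ω| ≤
      stoppedCondProb G p G₀ N (symmDiff E₁ E₂) ω := by
  rw [stoppedCondProb_eq_real, stoppedCondProb_eq_real, stoppedCondProb_eq_real]
  have h1 : MeasurableSet {ζ : BondConfig V | ω \ ↑(G₀ \ N ω) ∪ ↑(obs ζ (G₀ \ N ω)) ∈ E₁} :=
    measurableSet_setOf_obs (G₀ \ N ω) (fun ξ => ω \ ↑(G₀ \ N ω) ∪ (↑ξ : Set (Sym2 V)) ∈ E₁)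
  have h2 : MeasurableSet {ζ : BondConfig V | ω \ ↑(G₀ \ N ω) ∪ ↑(obs ζ (G₀ \ N ω)) ∈ E₂} :=
    measurableSet_setOf_obs (G₀ \ N ω) (fun ξ => ω \ ↑(G₀ \ N ω) ∪ (↑ξ : Set (Sym2 V)) ∈ E₂)
  refine (abs_measureReal_sub_le_measureReal_symmDiff h1.nullMeasurableSet h2.nullMeasurableSet).trans
    (le_of_eq ?_)
  congr 1

/-- **Conditioning on a data event**: for `A ∈ stoppedSigma G₀ N`, `Ỹ_{A ∩ E} = 𝟙_A · Ỹ_E`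
(gluing inside the unexplored block does not change membership in `A`). [cite: SchrammSmirnov2011, §4, proof of Prop. 4.1 (p. 20)] -/
theorem stoppedCondProb_inter_eq_indicator_mul {A : Set (BondConfig V)}
    (hA : MeasurableSet[stoppedSigma G₀ N] A) (E : Set (BondConfig V)) (ω : BondConfig V) :
    stoppedCondProb G p G₀ N (A ∩ E) ω =
      A.indicator (1 : BondConfig V → ℝ) ω * stoppedCondProb G p G₀ N E ω := by
  have hmem : ∀ ζ : BondConfig V, ω \ ↑(G₀ \ N ω) ∪ (↑(obs ζ (G₀ \ N ω)) : Set (Sym2 V)) ∈ A ↔ ω ∈ A := by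
    intro ζ
    refine (hA.2 ω _ fun e he => ?_).symm
    have heB : e ∉ G₀ \ N ω := by
      rw [Finset.mem_sdiff, not_and, not_not]
      intro heG
      rcases he with he | he
      · exact he
      · exact absurd heG he
    simp only [mem_union, Set.mem_sdiff, Finset.mem_coe, heB, not_false_eq_true, and_true, coe_obs,
      mem_inter_iff, and_false, or_false]
  rw [stoppedCondProb_eq_real, stoppedCondProb_eq_real]
  by_cases hω : ω ∈ A
  · rw [Set.indicator_of_mem hω, Pi.one_apply, one_mul]
    congr 1
    ext ζ
    simp only [mem_setOf_eq, mem_inter_iff, and_iff_right_iff_imp]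
    exact fun _ => (hmem ζ).2 hω
  · rw [Set.indicator_of_notMem hω, zero_mul]
    have : {ζ : BondConfig V | ω \ ↑(G₀ \ N ω) ∪ ↑(obs ζ (G₀ \ N ω)) ∈ A ∩ E} = ∅ := by
      ext ζ
      simp only [mem_setOf_eq, mem_inter_iff, mem_empty_iff_false, iff_false, not_and]
      intro h
      exact absurd ((hmem ζ).1 h) hω
    rw [this, measureReal_empty]

/-! ### Unbiasedness: `Ỹ` is a version of `E_p[𝟙_E | explored data]` -/

omit [DecidableEq V] [Countable V] in
/-- The window splits every set along the pieces: `A = ⋃_{F ⊆ G₀} A ∩ {N = F}`. [folklore] -/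
theorem eq_biUnion_inter_setOf_apply_eq (hNG : ∀ ω, N ω ⊆ G₀) (A : Set (BondConfig V)) :
    A = ⋃ F ∈ G₀.powerset, A ∩ {ω : BondConfig V | N ω = F} := by
  ext ω
  simp only [mem_iUnion, mem_inter_iff, mem_setOf_eq, exists_prop]
  exact ⟨fun h => ⟨N ω, Finset.mem_powerset.2 (hNG ω), h, rfl⟩, fun ⟨_, _, h, _⟩ => h⟩

omit [DecidableEq V] [Countable V] in
/-- Integrals split along the pieces: `∫_A f = Σ_{F ⊆ G₀} ∫_{A ∩ {N = F}} f`. [folklore] -/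
theorem setIntegral_eq_sum_setIntegral_inter (hN : IsStoppingSet N) (hNG : ∀ ω, N ω ⊆ G₀)
    {A : Set (BondConfig V)} (hA : MeasurableSet A) {f : BondConfig V → ℝ}
    (hf : Integrable f (bondPercolation G p)) :
    ∫ ω in A, f ω ∂(bondPercolation G p) =
      ∑ F ∈ G₀.powerset, ∫ ω in A ∩ {ω : BondConfig V | N ω = F}, f ω ∂(bondPercolation G p) := by
  conv_lhs => rw [eq_biUnion_inter_setOf_apply_eq hNG A]
  refine integral_biUnion_finset _ (fun F _ => hA.inter (hN.measurableSet_setOf_apply_eq F)) ?_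
    (fun F _ => hf.integrableOn)
  intro F _ F' _ hne
  refine Set.disjoint_left.2 fun ω h h' => hne ?_
  rw [← (h.2 : N ω = F), ← (h'.2 : N ω = F')]

/-- **Unbiasedness of the unexplored block**: for every event `A` of the explored data,
`∫_A Ỹ dP_p = ∫_A 𝟙_E dP_p` ("given `M` and the restriction of `ω` to it, the conditional law of the
restriction of `ω` to `M'` is unbiased … This follows directly from the fact that
`M(ω₂) = M(ω)`").  On the piece `{N = F}`, `Ỹ = P_p(E | ω off (G₀ ∖ F))`, a version of
`E_p[𝟙_E | σ((G₀ ∖ F)ᶜ)]`, and `A ∩ {N = F}` is a `σ((G₀ ∖ F)ᶜ)`-event.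
[cite: SchrammSmirnov2011, §4, proof of Prop. 4.1 (p. 18)] -/
theorem setIntegral_stoppedCondProb (hN : IsStoppingSet N) (hNG : ∀ ω, N ω ⊆ G₀)
    {E : Set (BondConfig V)} (hE : MeasurableSet E) {A : Set (BondConfig V)}
    (hA : MeasurableSet[stoppedSigma G₀ N] A) :
    ∫ ω in A, stoppedCondProb G p G₀ N E ω ∂(bondPercolation G p) =
      ∫ ω in A, E.indicator (1 : BondConfig V → ℝ) ω ∂(bondPercolation G p) := by
  set P := bondPercolation G p with hP
  have hYint : Integrable (stoppedCondProb G p G₀ N E) P :=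
    Integrable.of_bound (measurable_stoppedCondProb G p hN hNG hE).aestronglyMeasurable 1
      (ae_of_all _ fun ω => by rw [Real.norm_eq_abs]; exact abs_stoppedCondProb_le G p E ω)
  have hIint : Integrable (E.indicator (1 : BondConfig V → ℝ)) P := (integrable_const (1 : ℝ)).indicator hE
  rw [setIntegral_eq_sum_setIntegral_inter G p hN hNG hA.1 hYint,
    setIntegral_eq_sum_setIntegral_inter G p hN hNG hA.1 hIint]
  refine Finset.sum_congr rfl fun F _ => ?_
  have hAF : MeasurableSet (A ∩ {ω : BondConfig V | N ω = F}) :=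
    hA.1.inter (hN.measurableSet_setOf_apply_eq F)
  -- on the piece, `Ỹ = P_p(E | ω off (G₀ \ F))`
  have h1 : ∫ ω in A ∩ {ω : BondConfig V | N ω = F}, stoppedCondProb G p G₀ N E ω ∂P =
      ∫ ω in A ∩ {ω : BondConfig V | N ω = F}, blockCondProb G p (G₀ \ F) E ω ∂P := by
    refine setIntegral_congr_fun hAF fun ω hω => ?_
    unfold stoppedCondProb
    rw [(hω.2 : N ω = F)]
  -- which is a version of the conditional expectation given the edges off `G₀ \ F`
  have hm : edgeSigma ((↑(G₀ \ F) : Set (Sym2 V))ᶜ) ≤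
      (Set.instMeasurableSpace : MeasurableSpace (BondConfig V)) := edgeSigma_le _
  haveI : IsFiniteMeasure (P.trim hm) := isFiniteMeasure_trim hm
  have h2 : ∫ ω in A ∩ {ω : BondConfig V | N ω = F}, blockCondProb G p (G₀ \ F) E ω ∂P =
      ∫ ω in A ∩ {ω : BondConfig V | N ω = F},
        condExp (edgeSigma ((↑(G₀ \ F) : Set (Sym2 V))ᶜ)) P (E.indicator (1 : BondConfig V → ℝ)) ω ∂P :=
    setIntegral_congr_ae hAF ((blockCondProb_ae_eq_condExp G p (G₀ \ F) hE).mono fun ω hω _ => hω)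
  rw [h1, h2, hP, setIntegral_condExp hm hIint (hN.measurableSet_edgeSigma_inter_setOf_apply_eq hA F)]

/-- `E_p[Ỹ] = P_p(E)`. [cite: SchrammSmirnov2011, §4, proof of Prop. 4.1 (p. 18)] -/
theorem integral_stoppedCondProb (hN : IsStoppingSet N) (hNG : ∀ ω, N ω ⊆ G₀)
    {E : Set (BondConfig V)} (hE : MeasurableSet E) :
    ∫ ω, stoppedCondProb G p G₀ N E ω ∂(bondPercolation G p) = (bondPercolation G p).real E := by
  have h := setIntegral_stoppedCondProb G p hN hNG hE (A := univ) MeasurableSet.univ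
  rw [setIntegral_univ, setIntegral_univ, integral_indicator_one hE] at h
  exact h

/-- For a data event `A`: `∫_A Ỹ dP_p = P_p(A ∩ E)`. [cite: SchrammSmirnov2011, §4, proof of Prop. 4.1 (p. 18)] -/
theorem setIntegral_stoppedCondProb_eq_measureReal (hN : IsStoppingSet N) (hNG : ∀ ω, N ω ⊆ G₀)
    {E : Set (BondConfig V)} (hE : MeasurableSet E) {A : Set (BondConfig V)}
    (hA : MeasurableSet[stoppedSigma G₀ N] A) :
    ∫ ω in A, stoppedCondProb G p G₀ N E ω ∂(bondPercolation G p) = (bondPercolation G p).real (A ∩ E) := by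
  rw [setIntegral_stoppedCondProb G p hN hNG hE hA, setIntegral_indicator hE]
  simp only [Pi.one_apply, setIntegral_const, smul_eq_mul, mul_one]

/-- **`Ỹ` is a version of the conditional expectation `E_p[𝟙_E | explored data]`.**
[cite: SchrammSmirnov2011, §4, proof of Prop. 4.1 (p. 19, "Ỹ := P_η(ω̃ ∈ ⊞_{Q₀} | ω|_M)")] -/
theorem stoppedCondProb_ae_eq_condExp (hN : IsStoppingSet N) (hNG : ∀ ω, N ω ⊆ G₀)
    {E : Set (BondConfig V)} (hE : MeasurableSet E) :
    stoppedCondProb G p G₀ N E =ᵐ[bondPercolation G p]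
      (bondPercolation G p)[E.indicator (1 : BondConfig V → ℝ) | stoppedSigma G₀ N] := by
  have hm := stoppedSigma_le G₀ N
  haveI : IsFiniteMeasure ((bondPercolation G p).trim hm) := isFiniteMeasure_trim hm
  refine ae_eq_condExp_of_forall_setIntegral_eq hm ?_ ?_ ?_ ?_
  · exact (integrable_const (1 : ℝ)).indicator hE
  · intro s _ _
    exact (Integrable.of_bound (measurable_stoppedCondProb G p hN hNG hE).aestronglyMeasurable 1
      (ae_of_all _ fun ω => by rw [Real.norm_eq_abs]; exact abs_stoppedCondProb_le G p E ω)).integrableOn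
  · intro s hs _
    exact setIntegral_stoppedCondProb G p hN hNG hE hs
  · exact (measurable_stoppedCondProb_stoppedSigma G p hN hNG hE).stronglyMeasurable.aestronglyMeasurable

/-- **`∫ Ỹ g = ∫ 𝟙_E g` for bounded data-measurable `g`** (pull-out property of the conditional
expectation). [cite: SchrammSmirnov2011, §4, proof of Prop. 4.1 (p. 20)] -/
theorem integral_stoppedCondProb_mul (hN : IsStoppingSet N) (hNG : ∀ ω, N ω ⊆ G₀)
    {E : Set (BondConfig V)} (hE : MeasurableSet E) {g : BondConfig V → ℝ}
    (hg : Measurable[stoppedSigma G₀ N] g) {K : ℝ} (hgK : ∀ ω, |g ω| ≤ K) :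
    ∫ ω, stoppedCondProb G p G₀ N E ω * g ω ∂(bondPercolation G p) =
      ∫ ω, E.indicator (1 : BondConfig V → ℝ) ω * g ω ∂(bondPercolation G p) := by
  set P := bondPercolation G p with hP
  have hm := stoppedSigma_le G₀ N
  haveI : IsFiniteMeasure (P.trim hm) := isFiniteMeasure_trim hm
  have hgm : Measurable g := hg.mono hm le_rfl
  have hgsm : StronglyMeasurable[stoppedSigma G₀ N] g := hg.stronglyMeasurable
  have hIint : Integrable (E.indicator (1 : BondConfig V → ℝ)) P := (integrable_const (1 : ℝ)).indicator hE
  have hgint : Integrable g P :=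
    Integrable.of_bound hgm.aestronglyMeasurable K (ae_of_all _ fun ω => by rw [Real.norm_eq_abs]; exact hgK ω)
  have hgI : Integrable (g * E.indicator (1 : BondConfig V → ℝ)) P := by
    refine Integrable.of_bound (hgm.mul (measurable_one.indicator hE)).aestronglyMeasurable K
      (ae_of_all _ fun ω => ?_)
    rw [Real.norm_eq_abs, Pi.mul_apply, abs_mul]
    have h1 := abs_indicator_one_le E ω
    have h2 := hgK ω
    calc |g ω| * |E.indicator (1 : BondConfig V → ℝ) ω| ≤ |g ω| * 1 :=
          mul_le_mul_of_nonneg_left h1 (abs_nonneg _)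
      _ ≤ K := by rw [mul_one]; exact h2
  -- `∫ Ỹ g = ∫ E[𝟙_E | data] g = ∫ E[g 𝟙_E | data] = ∫ g 𝟙_E`
  have h1 : ∫ ω, stoppedCondProb G p G₀ N E ω * g ω ∂P =
      ∫ ω, condExp (stoppedSigma G₀ N) P (E.indicator (1 : BondConfig V → ℝ)) ω * g ω ∂P :=
    integral_congr_ae ((stoppedCondProb_ae_eq_condExp G p hN hNG hE).mono fun ω hω => by
      show stoppedCondProb G p G₀ N E ω * g ω = _; rw [hω])
  have h2 : (fun ω => condExp (stoppedSigma G₀ N) P (E.indicator (1 : BondConfig V → ℝ)) ω * g ω) =ᵐ[P]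
      condExp (stoppedSigma G₀ N) P (g * E.indicator (1 : BondConfig V → ℝ)) := by
    have h := condExp_mul_of_stronglyMeasurable_left (μ := P) hgsm hgI hIint
    refine h.mono fun ω hω => ?_
    show _ = condExp (stoppedSigma G₀ N) P (g * E.indicator (1 : BondConfig V → ℝ)) ω
    rw [hω, Pi.mul_apply, mul_comm]
  rw [h1, integral_congr_ae h2, integral_condExp hm]
  refine integral_congr_ae (ae_of_all _ fun ω => ?_)
  show (g * E.indicator (1 : BondConfig V → ℝ)) ω = _
  rw [Pi.mul_apply, mul_comm]

/-! ### `L²`-minimality -/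

/-- **`Ỹ` minimises `‖𝟙_E - X‖₂` among bounded data-measurable `X`** ("By its definition, `Ỹ`
minimizes `‖Ỹ₀ - X‖₂²` among `ω|_M`-measurable random variables `X`"): Pythagoras,
`‖𝟙_E - X‖₂² = ‖𝟙_E - Ỹ‖₂² + ‖Ỹ - X‖₂²`, the cross term vanishing by
`integral_stoppedCondProb_mul`. [cite: SchrammSmirnov2011, §4, proof of Prop. 4.1 (p. 20, "Final estimates")] -/
theorem integral_sq_indicator_sub_stoppedCondProb_le (hN : IsStoppingSet N) (hNG : ∀ ω, N ω ⊆ G₀)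
    {E : Set (BondConfig V)} (hE : MeasurableSet E) {X : BondConfig V → ℝ}
    (hX : Measurable[stoppedSigma G₀ N] X) {K : ℝ} (hXK : ∀ ω, |X ω| ≤ K) :
    ∫ ω, (E.indicator (1 : BondConfig V → ℝ) ω - stoppedCondProb G p G₀ N E ω) ^ 2 ∂(bondPercolation G p) ≤
      ∫ ω, (E.indicator (1 : BondConfig V → ℝ) ω - X ω) ^ 2 ∂(bondPercolation G p) := by
  set P := bondPercolation G p with hP
  set Y := stoppedCondProb G p G₀ N E with hY
  set I := E.indicator (1 : BondConfig V → ℝ) with hI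
  have hm := stoppedSigma_le G₀ N
  have hXm : Measurable X := hX.mono hm le_rfl
  have hYm : Measurable Y := measurable_stoppedCondProb G p hN hNG hE
  have hIm : Measurable I := measurable_one.indicator hE
  have hK : 0 ≤ K := (abs_nonneg _).trans (hXK ∅)
  have hY1 : ∀ ω, |Y ω| ≤ 1 := abs_stoppedCondProb_le G p E
  have hI1 : ∀ ω, |I ω| ≤ 1 := abs_indicator_one_le E
  -- the data-measurable bounded function `g = Y - X`
  have hg : Measurable[stoppedSigma G₀ N] (fun ω => Y ω - X ω) :=
    (measurable_stoppedCondProb_stoppedSigma G p hN hNG hE).sub hX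
  have hgK : ∀ ω, |Y ω - X ω| ≤ 1 + K := fun ω =>
    (abs_sub _ _).trans (add_le_add (hY1 ω) (hXK ω))
  -- the cross term vanishes
  have hcross : ∫ ω, (I ω - Y ω) * (Y ω - X ω) ∂P = 0 := by
    have h := integral_stoppedCondProb_mul G p hN hNG hE hg hgK
    have hint1 : Integrable (fun ω => I ω * (Y ω - X ω)) P :=
      Integrable.of_bound (hIm.mul (hYm.sub hXm)).aestronglyMeasurable (1 * (1 + K))
        (ae_of_all _ fun ω => by
          rw [Real.norm_eq_abs, abs_mul]
          exact mul_le_mul (hI1 ω) (hgK ω) (abs_nonneg _) zero_le_one)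
    have hint2 : Integrable (fun ω => Y ω * (Y ω - X ω)) P :=
      Integrable.of_bound (hYm.mul (hYm.sub hXm)).aestronglyMeasurable (1 * (1 + K))
        (ae_of_all _ fun ω => by
          rw [Real.norm_eq_abs, abs_mul]
          exact mul_le_mul (hY1 ω) (hgK ω) (abs_nonneg _) zero_le_one)
    have hsplit : (fun ω => (I ω - Y ω) * (Y ω - X ω)) =
        fun ω => I ω * (Y ω - X ω) - Y ω * (Y ω - X ω) := funext fun ω => by ring
    rw [hsplit, integral_sub hint1 hint2, ← h, sub_self]
  -- Pythagoras
  have hpt : ∀ ω, (I ω - X ω) ^ 2 =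
      (I ω - Y ω) ^ 2 + ((Y ω - X ω) ^ 2 + 2 * ((I ω - Y ω) * (Y ω - X ω))) := fun ω => by ring
  have hintA : Integrable (fun ω => (I ω - Y ω) ^ 2) P :=
    Integrable.of_bound ((hIm.sub hYm).pow_const 2).aestronglyMeasurable ((1 + 1) ^ 2)
      (ae_of_all _ fun ω => by
        rw [Real.norm_eq_abs, abs_pow]
        exact pow_le_pow_left₀ (abs_nonneg _) ((abs_sub _ _).trans (add_le_add (hI1 ω) (hY1 ω))) 2)
  have hintB : Integrable (fun ω => (Y ω - X ω) ^ 2) P :=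
    Integrable.of_bound ((hYm.sub hXm).pow_const 2).aestronglyMeasurable ((1 + K) ^ 2)
      (ae_of_all _ fun ω => by
        rw [Real.norm_eq_abs, abs_pow]
        exact pow_le_pow_left₀ (abs_nonneg _) (hgK ω) 2)
  have hintP : Integrable (fun ω => (I ω - Y ω) * (Y ω - X ω)) P :=
    Integrable.of_bound ((hIm.sub hYm).mul (hYm.sub hXm)).aestronglyMeasurable ((1 + 1) * (1 + K))
      (ae_of_all _ fun ω => by
        rw [Real.norm_eq_abs]
        show |(I ω - Y ω) * (Y ω - X ω)| ≤ (1 + 1) * (1 + K)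
        rw [abs_mul]
        exact mul_le_mul ((abs_sub _ _).trans (add_le_add (hI1 ω) (hY1 ω))) (hgK ω)
          (abs_nonneg _) (by norm_num))
  have hintC : Integrable (fun ω => 2 * ((I ω - Y ω) * (Y ω - X ω))) P := hintP.const_mul 2
  have hintBC : Integrable (fun ω => (Y ω - X ω) ^ 2 + 2 * ((I ω - Y ω) * (Y ω - X ω))) P :=
    hintB.add hintC
  have hBnonneg : 0 ≤ ∫ ω, (Y ω - X ω) ^ 2 ∂P := integral_nonneg fun ω => sq_nonneg _
  have hexp : ∫ ω, (I ω - X ω) ^ 2 ∂P =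
      ∫ ω, (I ω - Y ω) ^ 2 ∂P + (∫ ω, (Y ω - X ω) ^ 2 ∂P + 2 * ∫ ω, (I ω - Y ω) * (Y ω - X ω) ∂P) := by
    rw [← integral_const_mul, ← integral_add hintB hintC, ← integral_add hintA hintBC]
    exact integral_congr_ae (ae_of_all _ fun ω => hpt ω)
  rw [hexp, hcross, mul_zero, add_zero]
  linarith

/-- **`‖Ỹ₀ - Ỹ‖₂ ≤ ‖Ỹ₀ - Y_s‖₂`**: the adaptive conditional probability of `E` beats the block
conditional probability `P_p(E' | ω off B)` of ANY event `E'` for any block `B` that contains every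
unexplored block `G₀ ∖ N(ω)` ("comparison to `Y_s` (recall that the set `M` includes the
complement of the `s`-neighborhood of `α`) yields `‖Ỹ₀ - Ỹ‖₂ ≤ ‖Ỹ₀ - Y_s‖₂`"; in the source
`E = {ω̃ ∈ ⊞_{Q₀}}` and `E' = ⊞_{Q₀}`). [cite: SchrammSmirnov2011, §4, proof of Prop. 4.1 (p. 20, "Final estimates")] -/
theorem integral_sq_indicator_sub_stoppedCondProb_le_blockCondProb (hN : IsStoppingSet N)
    (hNG : ∀ ω, N ω ⊆ G₀) {E : Set (BondConfig V)} (hE : MeasurableSet E) (B : Finset (Sym2 V))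
    (hB : ∀ ω, G₀ \ N ω ⊆ B) {E' : Set (BondConfig V)} (hE' : MeasurableSet E') :
    ∫ ω, (E.indicator (1 : BondConfig V → ℝ) ω - stoppedCondProb G p G₀ N E ω) ^ 2 ∂(bondPercolation G p) ≤
      ∫ ω, (E.indicator (1 : BondConfig V → ℝ) ω - blockCondProb G p B E' ω) ^ 2 ∂(bondPercolation G p) :=
  integral_sq_indicator_sub_stoppedCondProb_le G p hN hNG hE
    (measurable_blockCondProb_stoppedSigma G p B hB hE') (abs_blockCondProb_le G p B E')

/-- **Approximation on a data event**: if on a data event `S` (e.g. the complement of the bad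
event `𝒮`) a measurable `Z` with `|Z| ≤ 1` satisfies `|Z - Ỹ_E| ≤ Ỹ_D` pointwise for some
measurable event `D`, then `∫_S (Z - Ỹ_E)² ≤ P_p(S ∩ D)` — the form of
"`|Ỹ_T - Ỹ| 𝟙_{¬𝒮} ≤ P_η(G^T ≠ G*, ¬𝒮 | ω|_M)`. By taking expectations …".
[cite: SchrammSmirnov2011, §4, proof of Prop. 4.1 (p. 20, eq. (4.6))] -/
theorem setIntegral_sq_sub_stoppedCondProb_le (hN : IsStoppingSet N) (hNG : ∀ ω, N ω ⊆ G₀)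
    {E D : Set (BondConfig V)} (hE : MeasurableSet E) (hD : MeasurableSet D)
    {S : Set (BondConfig V)} (hS : MeasurableSet[stoppedSigma G₀ N] S) {Z : BondConfig V → ℝ}
    (hZm : Measurable Z) (hZ1 : ∀ ω, |Z ω| ≤ 1)
    (hZ : ∀ ω ∈ S, |Z ω - stoppedCondProb G p G₀ N E ω| ≤ stoppedCondProb G p G₀ N D ω) :
    ∫ ω in S, (Z ω - stoppedCondProb G p G₀ N E ω) ^ 2 ∂(bondPercolation G p) ≤
      (bondPercolation G p).real (S ∩ D) := by
  set P := bondPercolation G p with hP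
  have hYm : Measurable (stoppedCondProb G p G₀ N E) := measurable_stoppedCondProb G p hN hNG hE
  have hDm : Measurable (stoppedCondProb G p G₀ N D) := measurable_stoppedCondProb G p hN hNG hD
  have hpt : ∀ ω ∈ S, (Z ω - stoppedCondProb G p G₀ N E ω) ^ 2 ≤ stoppedCondProb G p G₀ N D ω := by
    intro ω hω
    have h1 := hZ ω hω
    have h2 : |Z ω - stoppedCondProb G p G₀ N E ω| ≤ 1 + 1 :=
      (abs_sub _ _).trans (add_le_add (hZ1 ω) (abs_stoppedCondProb_le G p E ω))
    have h3 : (Z ω - stoppedCondProb G p G₀ N E ω) ^ 2 = |Z ω - stoppedCondProb G p G₀ N E ω| ^ 2 :=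
      (sq_abs _).symm
    have h4 : |Z ω - stoppedCondProb G p G₀ N E ω| ≤ 1 := by
      have := stoppedCondProb_le_one G p (G₀ := G₀) (N := N) D ω
      linarith
    rw [h3, sq]
    calc |Z ω - stoppedCondProb G p G₀ N E ω| * |Z ω - stoppedCondProb G p G₀ N E ω|
        ≤ 1 * |Z ω - stoppedCondProb G p G₀ N E ω| :=
          mul_le_mul_of_nonneg_right h4 (abs_nonneg _)
      _ ≤ stoppedCondProb G p G₀ N D ω := by rw [one_mul]; exact h1
  have hint1 : IntegrableOn (fun ω => (Z ω - stoppedCondProb G p G₀ N E ω) ^ 2) S P :=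
    (Integrable.of_bound ((hZm.sub hYm).pow_const 2).aestronglyMeasurable ((1 + 1) ^ 2)
      (ae_of_all _ fun ω => by
        rw [Real.norm_eq_abs, abs_pow]
        exact pow_le_pow_left₀ (abs_nonneg _)
          ((abs_sub _ _).trans (add_le_add (hZ1 ω) (abs_stoppedCondProb_le G p E ω))) 2)).integrableOn
  have hint2 : IntegrableOn (stoppedCondProb G p G₀ N D) S P :=
    (Integrable.of_bound hDm.aestronglyMeasurable 1
      (ae_of_all _ fun ω => by rw [Real.norm_eq_abs]; exact abs_stoppedCondProb_le G p D ω)).integrableOn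
  calc ∫ ω in S, (Z ω - stoppedCondProb G p G₀ N E ω) ^ 2 ∂P
      ≤ ∫ ω in S, stoppedCondProb G p G₀ N D ω ∂P :=
        setIntegral_mono_on hint1 hint2 (hS.1) hpt
    _ = P.real (S ∩ D) := setIntegral_stoppedCondProb_eq_measureReal G p hN hNG hD hS

end CondProbSum

end Literature.Probability.Percolation

end
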